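import Literature.MathematicalPhysics.QuantumFieldTheory.Federbush1986.NonAbelianDualityPlaquetteAction
import Literature.MathematicalPhysics.QuantumFieldTheory.Federbush1986.DecayEnvelope
import Literature.MathematicalPhysics.QuantumFieldTheory.Federbush1986.LatticeActionLimit

/-!
# `Federbush1986.NonAbelianDualityCoarseSummable` — [Federbush1987PhaseCellVI] THEOREM 2 p. 20, ingredient: EVERY LATTICE
# ACTION `S^r_0` OF THE ASSOCIATED FAMILY IS A CONVERGENT PLAQUETTE SUM (all levels `r`, including the coarse ones below the
# small-field threshold), for a potential decaying like `|x|^{−(2+ε)}` (theorems only)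

statement-level skeleton of published theorems with citation tags; proofs where landed; nothing here is a claim about the Yang–Mills mass gap

CITATION HEADER.  P. Federbush, *A phase cell approach to Yang–Mills theory. VI. Non-abelian lattice-continuum duality*,
Ann. Inst. H. Poincaré (Physique théorique) **47** (1987) 17–23, Numdam `AIHPA_1987__47_1_17_0` [Federbush1987PhaseCellVI]
(cell paper F6; pp. 18–23 READ AS IMAGES `run/shared/lean/pub/lit-balaban/lit-balaban-r19/renders/fedVI/fedVI-p003…p008.png`).
Unit `lit-balaban-r19` gen 5 (reader/typer r19; owner of the F6 statement file); SKELETON row **F6.Thm2** (statement of record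
`BlockSpinSystem.Theorem2Oriented`: its FIRST conjunct «every `S^r_0` is a convergent plaquette sum»).  Inputs BY NAME:
`blockSpin_eq_canonWord`, `wordHol_map/_congr`, `inflBox_succ`, `norm_segment_sub_src_le`, `eq_iterBlockSpin_of_compatible`,
`gApprox_congr_of_eqOn`, `cutoff` (`NonAbelianDualityLocality`, this unit gen 3), `mem_canonWord_base` (`NonAbelianDualityTopStep`),
`norm_F_le_of_estimates`, `iterBlockSpin_top/_self` (units r17), `gApprox_eq_exp_of_le` (`NonAbelianDualityPlaquetteAction`),
`norm_iterBlockSpinLog_logData_le_of_le` (`NonAbelianDualityPlaquetteCascade`), `theorem1_of_chart_tendsto`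
(`NonAbelianDualityTheorem1`, unit r17), `polyEnvelope`, `integrable_polyEnvelope_sum_sq` (`DecayEnvelope`, unit r17),
`LatticeRiemann.summable_of_dominated`, `tsum_plaq_eq_tsum_base` (`LatticeActionLimit`, unit r17).
HOME `run/shared/lean/pub/lit-balaban/`.

WHAT IS PRINTED.  VI p. 20: «S^r_0 = ¼ Σ_p |g_∂p|² (10) where the sum is over plaquettes in ℒ^r», Theorem 2 («the corresponding
lattice actions, S^r_0, converge») — on the infinite lattice `ℒ^r` the finiteness of each `S^r_0` for the assignments
associated to a potential with «||x|^{2+ε}A_μ(x)| < c» is part of what is asserted and is left to the reader.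

THE MATHEMATICS.  Fix a level `r` and a high auxiliary level `s = r + k` above the small-field threshold.  (§1) ONE block spin
at the group level in the small-field region: if the fine assignments on the letters of Federbush's words `Γ_x` of `e` have
`|u(f)| ≤ η ≤ η₀`, their logarithms exist by the chart (`|X_f| ≤ C|u(f)|`), `BS(u)(e) = exp F(X)` by (13)/(18) (`F_spec`,
`paths_canonical`), and `|F(X)| ≤ (‖F^L‖ + c₁)|X|` by (21): `|BS(u)(e)| ≤ Θη`, `Θ = C²(‖F^L‖ + c₁)`.  (§2) Iterating down `k`
levels over the influence boxes: `|X^{(r)}(u)(e)| ≤ Θ^k η` if `|u| ≤ η` on the level-`s` influence box of `e` and `Θ^kη ≤ η₀`.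
(§3) At the high level, far from the origin the associated assignments are small in proportion to the LOCAL size of the
potential: `|g(f)| ≤ QB₁′(f)ℓ_s` (`g(f) = lim g(f, n)`, the approximates being those of the cutoff `χ_fA`, in log coordinates
of size `≤ K₁B₁′ℓ_s`).  (§4) Hence by compatibility `g(r) = X^{(r)}(g(s))` and `|g_∂p| ≤ 4Θ^kQℓ_s·K(1 + (|x_p| − 17)₊)^{−(2+ε)}`
for all plaquettes outside a bounded set (a FINITE set of plaquettes of `ℒ^r`); the squares are dominated by an integrable radial
envelope, so `Σ_p [dir₁ ≠ dir₂]|g_∂p|²` converges (`summable_of_dominated` + finitely many exceptions).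

WHAT THIS MODULE PROVES (theorems only; no `def`, no `Prop` definition, no named fact; axioms standard).  §1
**`absG_blockSpin_le_of_chart`**; §2 **`absG_iterBlockSpin_le_of_chart`**; §3 `norm_cutoff_le_of_local`, **`absG_assoc_le_local`**;
§4 `abs_apply_le_norm_E4`, `finite_plaq_norm_src_lt`, `absG_plaqHol_le_sum`, **`summable_plaqActionTermOriented_assoc`**.
-/

namespace Literature.MathematicalPhysics.QuantumFieldTheory.Federbush1986

noncomputable section

open Filter Metric Set MeasureTheory LatticeRiemann
open scoped Topology BigOperators

namespace BlockSpinSystem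

variable (S : BlockSpinSystem)

/-! ## §1 One block spin in the small-field region, at the group level -/

/-- **One block spin of small assignments is small** (group level, through the chart): there are `Θ ≥ 0` and `η₀ > 0` such
that if `|u(f)| ≤ η ≤ η₀` for every letter `f` of the words `Γ_x` of `e`, then `|BS(u)(e)| ≤ Θη`.
[cite: Federbush1987PhaseCellVI, (13), (18), (21) p. 21, (1)–(2) p. 18] -/
theorem absG_blockSpin_le_of_chart (hFS : S.IsFederbushSystem)
    (hchart : ∃ ρ > (0 : ℝ), ∃ C ≥ (1 : ℝ),
      (∀ X Y : S.𝔤, ‖X‖ < ρ → ‖Y‖ < ρ →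
        C⁻¹ * ‖X - Y‖ ≤ dist (S.exp X) (S.exp Y) ∧ dist (S.exp X) (S.exp Y) ≤ C * ‖X - Y‖) ∧
      ∀ g : S.G, absG g < ρ / C → ∃ X : S.𝔤, ‖X‖ < ρ ∧ S.exp X = g) :
    ∃ Θ : ℝ, 0 ≤ Θ ∧ ∃ η₀ > (0 : ℝ), ∀ (j : ℕ) (u : Edge (j + 1) → S.G) (e : Edge j) (η : ℝ), 0 ≤ η →
      (∀ x, ∀ l ∈ canonWord j e x, absG (u l.1) ≤ η) → η ≤ η₀ → absG (S.blockSpin j u e) ≤ Θ * η := by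
  obtain ⟨ρ, hρ, C, hC1, hlip, hsurj⟩ := hchart
  obtain ⟨c₁, hc₁, ε₁, hε₁, HF⟩ := S.norm_F_le_of_estimates hFS.estimates
  have hC0 : 0 < C := lt_of_lt_of_le one_pos hC1
  have hεF := S.εF_pos
  obtain ⟨Λ, hΛdef⟩ : ∃ Λ : ℝ, Λ = ‖S.FL‖ + c₁ := ⟨_, rfl⟩
  have hΛ0 : 0 ≤ Λ := by rw [hΛdef]; positivity
  obtain ⟨m, hmdef⟩ : ∃ m : ℝ, m = min (min ρ S.εF) (min ε₁ 1) := ⟨_, rfl⟩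
  have hm0 : 0 < m := by rw [hmdef]; exact lt_min (lt_min hρ hεF) (lt_min hε₁ one_pos)
  have hmρ : m ≤ ρ := by rw [hmdef]; exact (min_le_left _ _).trans (min_le_left _ _)
  have hmF : m ≤ S.εF := by rw [hmdef]; exact (min_le_left _ _).trans (min_le_right _ _)
  have hm₁ : m ≤ ε₁ := by rw [hmdef]; exact (min_le_right _ _).trans (min_le_left _ _)
  have hm1 : m ≤ 1 := by rw [hmdef]; exact (min_le_right _ _).trans (min_le_right _ _)
  refine ⟨C * Λ * C, by positivity, m / (2 * C * (Λ + 1)), by positivity, ?_⟩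
  intro j u e η hη0 hsmall hη
  -- smallness bookkeeping: C η (Λ + 1) ≤ m / 2
  have hkey : C * η * (Λ + 1) ≤ m / 2 := by
    have h1 : C * η * (Λ + 1) ≤ C * (m / (2 * C * (Λ + 1))) * (Λ + 1) :=
      mul_le_mul_of_nonneg_right (mul_le_mul_of_nonneg_left hη hC0.le) (by positivity)
    have h2 : C * (m / (2 * C * (Λ + 1))) * (Λ + 1) = m / 2 := by field_simp
    linarith
  have hCη : C * η ≤ m / 2 := by nlinarith [mul_nonneg (mul_nonneg hC0.le hη0) hΛ0]
  have hCηρ : C * η < ρ := by linarith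
  have hCηF : C * η < S.εF := by linarith
  have hCη₁ : C * η < ε₁ := by linarith
  have hCη1 : C * η ≤ 1 := by linarith
  have hΛCη : Λ * (C * η) < ρ := by nlinarith [mul_nonneg hC0.le hη0]
  have hηρC : η < ρ / C := by
    rw [lt_div_iff₀ hC0]; linarith
  -- logarithms of small group elements through the chart
  have h0ρ : ‖(0 : S.𝔤)‖ < ρ := by simpa using hρ
  have hlog : ∀ g : S.G, absG g ≤ η → ∃ X : S.𝔤, ‖X‖ < ρ ∧ S.exp X = g ∧ ‖X‖ ≤ C * absG g := by
    intro g hg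
    obtain ⟨X, hX, hXg⟩ := hsurj g (hg.trans_lt hηρC)
    refine ⟨X, hX, hXg, ?_⟩
    have h := (hlip X 0 hX h0ρ).1
    rw [hXg, S.exp_zero hFS, sub_zero] at h
    rw [absG, dist_comm]
    calc ‖X‖ = C * (C⁻¹ * ‖X‖) := by field_simp
      _ ≤ C * dist g 1 := mul_le_mul_of_nonneg_left h hC0.le
  classical
  -- the letter logarithms (zero where the letter is not small, which no used letter is)
  obtain ⟨X, hXdef⟩ : ∃ X : Fin S.M → S.𝔤, X = fun α =>
      if h : absG (u (S.vars j e α)) ≤ η then Classical.choose (hlog _ h) else 0 := ⟨_, rfl⟩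
  have hXspec : ∀ α, absG (u (S.vars j e α)) ≤ η →
      ‖X α‖ < ρ ∧ S.exp (X α) = u (S.vars j e α) ∧ ‖X α‖ ≤ C * absG (u (S.vars j e α)) := by
    intro α h
    rw [hXdef]; simp only [dif_pos h]
    exact Classical.choose_spec (hlog _ h)
  have hXn : ∀ α, ‖X α‖ ≤ C * η := by
    intro α
    by_cases h : absG (u (S.vars j e α)) ≤ η
    · exact (hXspec α h).2.2.trans (mul_le_mul_of_nonneg_left h hC0.le)
    · rw [hXdef]; simp only [dif_neg h, norm_zero]; positivity
  have hXpi : ‖X‖ ≤ C * η := (pi_norm_le_iff_of_nonneg (by positivity)).2 hXn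
  have hXF : ∀ α, ‖X α‖ < S.εF := fun α => (hXn α).trans_lt hCηF
  -- (13)/(18): the block spin is exp F(X)
  have hspec := S.F_spec X hXF
  have hword : ∀ x, wordHol (fun α => S.exp (X α)) (S.paths x) = wordHol u (canonWord j e x) := by
    intro x
    rw [← hFS.paths_canonical j e x, ← wordHol_map u (S.vars j e) (S.paths x)]
    refine wordHol_congr _ fun l hl => ?_
    have hmem : (S.vars j e l.1, l.2) ∈ canonWord j e x := by
      rw [← hFS.paths_canonical j e x]; exact List.mem_map.2 ⟨l, hl, rfl⟩
    exact (hXspec l.1 (hsmall x _ hmem)).2.1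
  have hbs : S.blockSpin j u e = S.exp (S.F X) := by
    rw [S.blockSpin_eq_canonWord hFS j u e, hspec]
    congr 1
    funext x
    exact (hword x).symm
  -- (21): |F(X)| ≤ Λ|X|
  have hFX : ‖S.F X‖ ≤ Λ * (C * η) := by
    have h1 := HF X (hXpi.trans_lt hCη₁)
    have hX1 : ‖X‖ ≤ 1 := hXpi.trans hCη1
    have hsq : ‖X‖ ^ 2 ≤ ‖X‖ := by nlinarith [norm_nonneg X]
    calc ‖S.F X‖ ≤ ‖S.FL‖ * ‖X‖ + c₁ * ‖X‖ ^ 2 := h1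
      _ ≤ ‖S.FL‖ * ‖X‖ + c₁ * ‖X‖ := by nlinarith
      _ = Λ * ‖X‖ := by rw [hΛdef]; ring
      _ ≤ Λ * (C * η) := mul_le_mul_of_nonneg_left hXpi hΛ0
  -- |exp F(X)| ≤ C|F(X)|
  rw [hbs, absG, ← S.exp_zero hFS]
  have h := (hlip 0 (S.F X) h0ρ (hFX.trans_lt hΛCη)).2
  rw [zero_sub, norm_neg] at h
  calc dist (S.exp 0) (S.exp (S.F X)) ≤ C * ‖S.F X‖ := h
    _ ≤ C * (Λ * (C * η)) := mul_le_mul_of_nonneg_left hFX hC0.le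
    _ = C * Λ * C * η := by ring

/-! ## §2 Iterating down the influence boxes -/

/-- **`k` block spins of small assignments are small**: `|X^{(r)}(u)(e)| ≤ Θ^kη` if `|u(f)| ≤ η` on the level-`(r+k)` influence
box of `e` and `Θ^kη ≤ η₀` (`Θ ≥ 1`). [cite: Federbush1987PhaseCellVI, (1)–(2) p. 18, (13), (18), (21) p. 21; Federbush1986PhaseCellI,
§1 Fig. 1–2 p. 321–322] -/
theorem absG_iterBlockSpin_le_of_chart (hFS : S.IsFederbushSystem)
    (hchart : ∃ ρ > (0 : ℝ), ∃ C ≥ (1 : ℝ),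
      (∀ X Y : S.𝔤, ‖X‖ < ρ → ‖Y‖ < ρ →
        C⁻¹ * ‖X - Y‖ ≤ dist (S.exp X) (S.exp Y) ∧ dist (S.exp X) (S.exp Y) ≤ C * ‖X - Y‖) ∧
      ∀ g : S.G, absG g < ρ / C → ∃ X : S.𝔤, ‖X‖ < ρ ∧ S.exp X = g) :
    ∃ Θ : ℝ, 1 ≤ Θ ∧ ∃ η₀ > (0 : ℝ), ∀ (k r : ℕ) (u : Edge (r + k) → S.G) (e : Edge r) (η : ℝ), 0 ≤ η →
      (∀ f : Edge (r + k), inflBox e.base k f.base → absG (u f) ≤ η) → Θ ^ k * η ≤ η₀ →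
        absG (S.iterBlockSpin r (r + k) u e) ≤ Θ ^ k * η := by
  obtain ⟨Θ₁, hΘ₁, η₀, hη₀, H⟩ := S.absG_blockSpin_le_of_chart hFS hchart
  refine ⟨max Θ₁ 1, le_max_right _ _, η₀, hη₀, ?_⟩
  have hΘ1 : 1 ≤ max Θ₁ 1 := le_max_right _ _
  have hΘ0 : 0 ≤ max Θ₁ 1 := zero_le_one.trans hΘ1
  intro k
  induction k with
  | zero =>
    intro r u e η hη h _
    show absG (S.iterBlockSpin r r u e) ≤ (max Θ₁ 1) ^ 0 * η
    rw [S.iterBlockSpin_self, pow_zero, one_mul]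
    exact h e (inflBox_zero e.base)
  | succ k ih =>
    intro r u e η hη h hcond
    show absG (S.iterBlockSpin r (r + k + 1) u e) ≤ (max Θ₁ 1) ^ (k + 1) * η
    rw [S.iterBlockSpin_top r (r + k) (Nat.le_add_right r k)]
    have hηη₀ : η ≤ η₀ := by
      have h1 : η ≤ (max Θ₁ 1) ^ (k + 1) * η := le_mul_of_one_le_left hη (one_le_pow₀ hΘ1)
      exact h1.trans hcond
    have hstep : ∀ f : Edge (r + k), inflBox e.base k f.base → absG (S.blockSpin (r + k) u f) ≤ max Θ₁ 1 * η := by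
      intro f hf
      obtain ⟨b', μ'⟩ := f
      have h1 : ∀ x, ∀ l ∈ canonWord (r + k) ⟨b', μ'⟩ x, absG (u l.1) ≤ η := fun x l hl =>
        h l.1 (inflBox_succ hf (mem_canonWord_base b' μ' x l hl))
      exact (H (r + k) u ⟨b', μ'⟩ η hη h1 hηη₀).trans (mul_le_mul_of_nonneg_right (le_max_left _ _) hη)
    have hcond' : (max Θ₁ 1) ^ k * (max Θ₁ 1 * η) ≤ η₀ := by
      calc (max Θ₁ 1) ^ k * (max Θ₁ 1 * η) = (max Θ₁ 1) ^ (k + 1) * η := by ring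
        _ ≤ η₀ := hcond
    calc absG (S.iterBlockSpin r (r + k) (S.blockSpin (r + k) u) e) ≤ (max Θ₁ 1) ^ k * (max Θ₁ 1 * η) :=
          ih r (S.blockSpin (r + k) u) e (max Θ₁ 1 * η) (by positivity) hstep hcond'
      _ = (max Θ₁ 1) ^ (k + 1) * η := by ring

/-! ## §3 Far from the origin the associated assignments are small in proportion to the local size of the potential -/

/-- The cutoff `χ_cA` is bounded by the local bound of `A` on `closedBall c 10`. [cite: Federbush1987PhaseCellVI, Theorem 1 p. 20] -/
theorem norm_cutoff_le_of_local (c : E4) (A : S.Potential) {B₁' : ℝ} (hB₁' : 0 ≤ B₁')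
    (hloc : ∀ y ∈ closedBall c 10, ∀ μ, ‖A y μ‖ ≤ B₁') (y : E4) (μ : Fin 4) : ‖S.cutoff c 9 A y μ‖ ≤ B₁' := by
  have hrOut : (bumpAt c 9).rOut = 10 := by show max (9 : ℝ) 1 + 1 = 10; norm_num
  have hts : tsupport (bumpAt c 9) = closedBall c 10 := by rw [ContDiffBump.tsupport_eq, hrOut]
  show ‖(bumpAt c 9) y • A y μ‖ ≤ B₁'
  rw [norm_smul, Real.norm_eq_abs, abs_of_nonneg (bumpAt c 9).nonneg]
  by_cases hy : y ∈ closedBall c 10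
  · calc (bumpAt c 9) y * ‖A y μ‖ ≤ 1 * B₁' :=
        mul_le_mul (bumpAt c 9).le_one (hloc y hy μ) (norm_nonneg _) zero_le_one
      _ = B₁' := one_mul _
  · have : (bumpAt c 9) y = 0 := image_eq_zero_of_notMem_tsupport (by rwa [hts])
    rw [this, zero_mul]; exact hB₁'

/-- **Far-field smallness of the associated assignments at high levels**: for Federbush's scheme under the chart, a `C¹`
potential bounded by `B₁`, and its associated family `g`: there are `Q ≥ 0` and a level `s₅` such that for `s > s₅` and every
edge `f` of `ℒ^s`, `|g(f)| ≤ QB₁′ℓ_s` for every bound `B₁′ ≥ 0` of `|A|` on `closedBall x_f 10`. [cite: Federbush1987PhaseCellVI,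
(11)–(12) p. 20, (13) p. 21, (26) p. 22, Theorem 1 p. 20] -/
theorem absG_assoc_le_local (hFS : S.IsFederbushSystem)
    (hchart : ∃ ρ > (0 : ℝ), ∃ C ≥ (1 : ℝ),
      (∀ X Y : S.𝔤, ‖X‖ < ρ → ‖Y‖ < ρ →
        C⁻¹ * ‖X - Y‖ ≤ dist (S.exp X) (S.exp Y) ∧ dist (S.exp X) (S.exp Y) ≤ C * ‖X - Y‖) ∧
      ∀ g : S.G, absG g < ρ / C → ∃ X : S.𝔤, ‖X‖ < ρ ∧ S.exp X = g)
    (A : S.Potential) (hA : ContDiff ℝ 1 A) {B₁ : ℝ} (hB₁ : ∀ x μ, ‖A x μ‖ ≤ B₁)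
    {g : (r : ℕ) → Edge r → S.G} (hg : S.IsAssociated A g) :
    ∃ Q : ℝ, 0 ≤ Q ∧ ∃ s₅ : ℕ, ∀ s, s₅ < s → ∀ (f : Edge s) (B₁' : ℝ), 0 ≤ B₁' →
      (∀ y ∈ closedBall f.src 10, ∀ μ, ‖A y μ‖ ≤ B₁') → absG (g s f) ≤ Q * B₁' * latLen s := by
  have hB₁0 : 0 ≤ B₁ := (norm_nonneg _).trans (hB₁ 0 0)
  obtain ⟨g', -, htend, huniq⟩ := S.theorem1_of_chart_tendsto hchart hFS A hA
  have hgg : g = g' := huniq g hg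
  obtain ⟨ρ, hρ, C, hC1, hlip, -⟩ := hchart
  have hC0 : 0 < C := lt_of_lt_of_le one_pos hC1
  obtain ⟨K₁, hK₁, HK⟩ := S.norm_iterBlockSpinLog_logData_le_of_le hFS
  have hK₁0 : 0 ≤ K₁ := by linarith
  obtain ⟨s₁, Hs⟩ := HK B₁ hB₁0
  obtain ⟨s₄, Hrep⟩ := S.gApprox_eq_exp_of_le hFS B₁ hB₁0
  obtain ⟨sρ, Hρ⟩ := exists_latLen_lt (show 0 < ρ / (K₁ * B₁ + 1) by positivity)
  refine ⟨C * K₁, by positivity, max (max s₁ s₄) sρ, ?_⟩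
  intro s hs f B₁' hB₁'0 hloc
  have hs₁ : s₁ < s := lt_of_le_of_lt ((le_max_left _ _).trans (le_max_left _ _)) hs
  have hs₄ : s₄ < s := lt_of_le_of_lt ((le_max_right _ _).trans (le_max_left _ _)) hs
  have hsρ : latLen s < ρ / (K₁ * B₁ + 1) := Hρ s ((le_max_right _ _).trans hs.le)
  have hℓ := latLen_pos s
  have hℓ1 := latLen_le_one s
  -- local bound below the global one, and the cutoff
  obtain ⟨m₁, hm₁def⟩ : ∃ m₁ : ℝ, m₁ = min B₁' B₁ := ⟨_, rfl⟩
  have hm₁0 : 0 ≤ m₁ := by rw [hm₁def]; exact le_min hB₁'0 hB₁0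
  have hm₁B : m₁ ≤ B₁ := by rw [hm₁def]; exact min_le_right _ _
  have hm₁B' : m₁ ≤ B₁' := by rw [hm₁def]; exact min_le_left _ _
  have hloc' : ∀ y ∈ closedBall f.src 10, ∀ μ, ‖A y μ‖ ≤ m₁ := fun y hy μ => by
    rw [hm₁def]; exact le_min (hloc y hy μ) (hB₁ y μ)
  have hA'b : ∀ y μ, ‖S.cutoff f.src 9 A y μ‖ ≤ m₁ := S.norm_cutoff_le_of_local f.src A hm₁0 hloc'
  have hEq : ∀ y ∈ closedBall f.src 9, S.cutoff f.src 9 A y = A y := fun y hy => S.cutoff_eq_of_mem A hy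
  -- the approximates of the cutoff: exp of a small logarithm
  have happ : ∀ n, s ≤ n → absG (S.gApprox (S.cutoff f.src 9 A) n s f) ≤ C * K₁ * m₁ * latLen s := by
    intro n hn
    have hsize := Hs (S.cutoff f.src 9 A) m₁ hA'b hm₁B n s hs₁ hn f
    have hsmall : ‖S.iterBlockSpinLog s n (S.logData (S.cutoff f.src 9 A) n) f‖ < ρ := by
      have h1 : K₁ * m₁ * latLen s ≤ (K₁ * B₁ + 1) * latLen s := by
        apply mul_le_mul_of_nonneg_right _ hℓ.le; nlinarith [mul_le_mul_of_nonneg_left hm₁B hK₁0]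
      have h2 : (K₁ * B₁ + 1) * latLen s < ρ := by rw [lt_div_iff₀ (by positivity)] at hsρ; linarith
      linarith
    rw [Hrep (S.cutoff f.src 9 A) m₁ hA'b hm₁B n s hs₄ hn f, absG, ← S.exp_zero hFS]
    have h := (hlip 0 _ (by simpa using hρ) hsmall).2
    rw [zero_sub, norm_neg] at h
    calc _ ≤ C * ‖S.iterBlockSpinLog s n (S.logData (S.cutoff f.src 9 A) n) f‖ := h
      _ ≤ C * (K₁ * m₁ * latLen s) := mul_le_mul_of_nonneg_left hsize hC0.le
      _ = C * K₁ * m₁ * latLen s := by ring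
  -- they are the approximates of A at f, converging to g(f)
  have hconv : Tendsto (fun n => S.gApprox (S.cutoff f.src 9 A) n s f) atTop (𝓝 (g s f)) := by
    have h1 : (fun n => S.gApprox (S.cutoff f.src 9 A) n s f) = fun n => S.gApprox A n s f := by
      funext n
      refine (S.gApprox_congr_of_eqOn hFS f (fun y hy => (hEq y ?_).symm) n).symm
      rw [mem_closedBall] at hy ⊢
      linarith
    rw [h1, hgg]
    exact htend s f
  have habs : Tendsto (fun n => absG (S.gApprox (S.cutoff f.src 9 A) n s f)) atTop (𝓝 (absG (g s f))) := by
    have hc : Continuous fun x : S.G => absG x := by unfold absG; fun_prop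
    exact (hc.tendsto _).comp hconv
  have hlim := le_of_tendsto habs (eventually_atTop.2 ⟨s, fun n hn => happ n hn⟩)
  calc absG (g s f) ≤ C * K₁ * m₁ * latLen s := hlim
    _ ≤ C * K₁ * B₁' * latLen s := by
        apply mul_le_mul_of_nonneg_right _ hℓ.le
        exact mul_le_mul_of_nonneg_left hm₁B' (by positivity)

/-! ## §4 Summability of the oriented plaquette action at every level -/

/-- A coordinate is bounded by the Euclidean norm. [folklore] -/
private theorem abs_apply_le_norm_E4 (x : E4) (k : Fin 4) : |x k| ≤ ‖x‖ := by
  have h := PiLp.norm_apply_le x k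
  rwa [Real.norm_eq_abs] at h

/-- The plaquettes of `ℒ^r` with base vertex in a bounded region form a finite set. [cite: Federbush1987PhaseCellVI, (10) p. 20] -/
theorem finite_plaq_norm_src_lt (r : ℕ) (R : ℝ) : {p : Plaq r | ‖p.src‖ < R}.Finite := by
  have hℓ := latLen_pos r
  obtain ⟨N, hN⟩ : ∃ N : ℕ, R / latLen r ≤ N := exists_nat_ge _
  set T : Set ((Fin 4 → ℤ) × (Fin 4 × Fin 4)) :=
    (Set.pi Set.univ fun _ : Fin 4 => Set.Icc (-(N : ℤ)) N) ×ˢ Set.univ with hT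
  have hTfin : T.Finite := (Set.Finite.pi fun _ => Set.finite_Icc _ _).prod (Set.finite_univ)
  have hφ : Function.Injective (Plaq.equivProd r).symm := (Plaq.equivProd r).symm.injective
  refine (hTfin.preimage hφ.injOn).subset fun p hp => ?_
  simp only [Set.mem_setOf_eq] at hp
  simp only [Set.mem_preimage, hT, Set.mem_prod, Set.mem_pi, Set.mem_univ, true_implies, Set.mem_Icc, and_true]
  intro k
  have h1 : |p.src k| ≤ ‖p.src‖ := abs_apply_le_norm_E4 _ k
  have h2 : p.src k = latLen r * (p.base k : ℝ) := by simp [Plaq.src, mkPt]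
  rw [h2, abs_mul, abs_of_pos hℓ] at h1
  have h3 : |(p.base k : ℝ)| ≤ N := by
    have : |(p.base k : ℝ)| < R / latLen r := by rw [lt_div_iff₀ hℓ]; linarith
    exact this.le.trans hN
  have h4 : |((Plaq.equivProd r).symm p).1 k| ≤ (N : ℤ) := by
    have : ((Plaq.equivProd r).symm p).1 = p.base := rfl
    rw [this]
    exact_mod_cast h3
  exact abs_le.1 h4

/-- `|g_∂p| ≤ Σ_i |g(e_i)|` (invariant metric). [cite: Federbush1987PhaseCellVI, (10) p. 20; Federbush1987PhaseCellIII, p. 297] -/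
theorem absG_plaqHol_le_sum {r : ℕ} (u : Edge r → S.G) (p : Plaq r) :
    absG (S.plaqHol u p) ≤ absG (u ⟨p.base, p.dir₁⟩) + absG (u ⟨p.base + Pi.single p.dir₁ 1, p.dir₂⟩) +
      absG (u ⟨p.base + Pi.single p.dir₂ 1, p.dir₁⟩) + absG (u ⟨p.base, p.dir₂⟩) := by
  unfold plaqHol
  calc _ ≤ absG (u ⟨p.base, p.dir₁⟩ * u ⟨p.base + Pi.single p.dir₁ 1, p.dir₂⟩ *
          (u ⟨p.base + Pi.single p.dir₂ 1, p.dir₁⟩)⁻¹) + absG ((u ⟨p.base, p.dir₂⟩)⁻¹) := abs_mul_le _ _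
    _ ≤ absG (u ⟨p.base, p.dir₁⟩ * u ⟨p.base + Pi.single p.dir₁ 1, p.dir₂⟩) +
          absG ((u ⟨p.base + Pi.single p.dir₂ 1, p.dir₁⟩)⁻¹) + absG ((u ⟨p.base, p.dir₂⟩)⁻¹) :=
        add_le_add (abs_mul_le _ _) le_rfl
    _ ≤ absG (u ⟨p.base, p.dir₁⟩) + absG (u ⟨p.base + Pi.single p.dir₁ 1, p.dir₂⟩) +
          absG ((u ⟨p.base + Pi.single p.dir₂ 1, p.dir₁⟩)⁻¹) + absG ((u ⟨p.base, p.dir₂⟩)⁻¹) :=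
        add_le_add (add_le_add (abs_mul_le _ _) le_rfl) le_rfl
    _ = _ := by rw [abs_inv, abs_inv]

/-- The source of the edge at `b + e_i` is the source at `b` shifted by `ℓ_r e_i`. [cite: Federbush1986PhaseCellI, §1 p. 321] -/
private theorem src_add_single₈ {r : ℕ} (b : Fin 4 → ℤ) (i ν ν' : Fin 4) :
    (⟨b + Pi.single i 1, ν⟩ : Edge r).src = (⟨b, ν'⟩ : Edge r).src + latLen r • unitVec i := by
  simp only [Edge.src, mkPt, unitVec]
  rw [show (EuclideanSpace.single i (1 : ℝ) : E4) = WithLp.toLp 2 (Pi.single i (1 : ℝ)) from rfl,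
    ← WithLp.toLp_smul, ← WithLp.toLp_add]
  congr 1
  funext k
  rw [Pi.add_apply, Pi.add_apply, Pi.smul_apply, Pi.single_apply, Pi.single_apply]
  split_ifs <;> push_cast <;> ring

/-- **Every lattice action `S^r_0` of the associated family is a convergent plaquette sum** — the first conjunct of Theorem 2
as typed (`Theorem2Oriented`), at ALL levels `r`: for Federbush's scheme under the chart (T-F6-1), a `C¹` potential with
`|A_μ(x)| ≤ K(1 + |x|)^{−q}`, `q > 2`, and its associated family `g`, `Σ_p [dir₁ ≠ dir₂]|g_∂p(g(r))|²` is summable.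
[cite: Federbush1987PhaseCellVI, Theorem 2 p. 20, (10) p. 20] -/
theorem summable_plaqActionTermOriented_assoc (hFS : S.IsFederbushSystem)
    (hchart : ∃ ρ > (0 : ℝ), ∃ C ≥ (1 : ℝ),
      (∀ X Y : S.𝔤, ‖X‖ < ρ → ‖Y‖ < ρ →
        C⁻¹ * ‖X - Y‖ ≤ dist (S.exp X) (S.exp Y) ∧ dist (S.exp X) (S.exp Y) ≤ C * ‖X - Y‖) ∧
      ∀ g : S.G, absG g < ρ / C → ∃ X : S.𝔤, ‖X‖ < ρ ∧ S.exp X = g)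
    (A : S.Potential) (hA : ContDiff ℝ 1 A) {K q : ℝ} (hK : 0 ≤ K) (hq : 2 < q)
    (hdec : ∀ x μ, ‖A x μ‖ ≤ K * (1 + ‖x‖) ^ (-q))
    {g : (r : ℕ) → Edge r → S.G} (hg : S.IsAssociated A g) (r : ℕ) :
    Summable (S.plaqActionTermOriented r (g r)) := by
  have hq0 : 0 ≤ q := by linarith
  -- global bound
  have hB₁ : ∀ x μ, ‖A x μ‖ ≤ K := fun x μ => (hdec x μ).trans <| by
    have : (1 + ‖x‖) ^ (-q) ≤ 1 :=
      Real.rpow_le_one_of_one_le_of_nonpos (by linarith [norm_nonneg x]) (by linarith)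
    nlinarith
  obtain ⟨Θ, hΘ1, η₀, hη₀, Hit⟩ := S.absG_iterBlockSpin_le_of_chart hFS hchart
  have hΘ0 : 0 ≤ Θ := zero_le_one.trans hΘ1
  obtain ⟨Q, hQ, s₅, Hfar⟩ := S.absG_assoc_le_local hFS hchart A hA hB₁ hg
  -- the auxiliary high level s = r + k
  obtain ⟨k, hk⟩ : ∃ k : ℕ, s₅ < r + k := ⟨s₅ + 1, by omega⟩
  have hℓr := latLen_pos r
  have hℓr1 := latLen_le_one r
  have hℓs := latLen_pos (r + k)
  -- the envelope
  have henv_anti : Antitone (polyEnvelope K q) := polyEnvelope_antitone hK hq0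
  have hdec' : ∀ y μ, ‖A y μ‖ ≤ polyEnvelope K q ‖y‖ := fun y μ => by rw [polyEnvelope_norm]; exact hdec y μ
  -- far-field bound at the high level over the influence box of a level-r edge
  have hfarf : ∀ (e : Edge r) (f : Edge (r + k)), inflBox e.base k f.base →
      absG (g (r + k) f) ≤ Q * polyEnvelope K q (‖e.src‖ - 16) * latLen (r + k) := by
    intro e f hf
    refine Hfar (r + k) hk f _ (polyEnvelope_nonneg hK _ _) fun y hy μ => (hdec' y μ).trans (henv_anti ?_)
    have h1 : ‖f.src - e.src‖ ≤ 6 * latLen r := by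
      have h := norm_segment_sub_src_le (Nat.le_add_right r k) e f (by simpa using hf) (t := 0)
        ⟨le_rfl, (latLen_pos _).le⟩
      simpa using h
    rw [mem_closedBall, dist_eq_norm] at hy
    have h2 : ‖e.src‖ ≤ ‖y‖ + ‖y - f.src‖ + ‖f.src - e.src‖ := by
      calc ‖e.src‖ = ‖y - ((y - f.src) + (f.src - e.src))‖ := by congr 1; abel
        _ ≤ ‖y‖ + ‖(y - f.src) + (f.src - e.src)‖ := norm_sub_le _ _
        _ ≤ ‖y‖ + (‖y - f.src‖ + ‖f.src - e.src‖) := add_le_add le_rfl (norm_add_le _ _)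
        _ = _ := by ring
    linarith
  -- the level-r edges: compatibility + iteration
  have hgr : g r = S.iterBlockSpin r (r + k) (g (r + k)) := S.eq_iterBlockSpin_of_compatible hg.1 r k (r + k) rfl
  have hedge : ∀ e : Edge r, Θ ^ k * (Q * polyEnvelope K q (‖e.src‖ - 16) * latLen (r + k)) ≤ η₀ →
      absG (g r e) ≤ Θ ^ k * (Q * polyEnvelope K q (‖e.src‖ - 16) * latLen (r + k)) := by
    intro e hcond
    rw [hgr]
    exact Hit k r (g (r + k)) e _ (by have := polyEnvelope_nonneg hK q (‖e.src‖ - 16); positivity)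
      (hfarf e) hcond
  -- the plaquette envelope ψ(p)
  obtain ⟨c₀, hc₀def⟩ : ∃ c₀ : ℝ, c₀ = Θ ^ k * Q * latLen (r + k) := ⟨_, rfl⟩
  have hc₀0 : 0 ≤ c₀ := by rw [hc₀def]; positivity
  have hedge' : ∀ (e : Edge r) (t : ℝ), t ≤ ‖e.src‖ - 16 → c₀ * polyEnvelope K q t ≤ η₀ →
      absG (g r e) ≤ c₀ * polyEnvelope K q t := by
    intro e t ht hcond
    have hmono : polyEnvelope K q (‖e.src‖ - 16) ≤ polyEnvelope K q t := henv_anti ht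
    have h1 : Θ ^ k * (Q * polyEnvelope K q (‖e.src‖ - 16) * latLen (r + k)) = c₀ * polyEnvelope K q (‖e.src‖ - 16) := by
      rw [hc₀def]; ring
    have h2 : c₀ * polyEnvelope K q (‖e.src‖ - 16) ≤ c₀ * polyEnvelope K q t := mul_le_mul_of_nonneg_left hmono hc₀0
    have h3 := hedge e (by rw [h1]; exact h2.trans hcond)
    rw [h1] at h3
    exact h3.trans h2
  have hu : ∀ i : Fin 4, ‖unitVec i‖ = 1 := fun i => by simp [unitVec]
  -- the four edges of p have sources within ℓ_r ≤ 1 of x_p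
  have hsrc : ∀ (p : Plaq r), ∀ e ∈ [(⟨p.base, p.dir₁⟩ : Edge r), ⟨p.base + Pi.single p.dir₁ 1, p.dir₂⟩,
      ⟨p.base + Pi.single p.dir₂ 1, p.dir₁⟩, ⟨p.base, p.dir₂⟩], ‖p.src‖ - 17 ≤ ‖e.src‖ - 16 := by
    intro p e he
    have key : ‖e.src - p.src‖ ≤ 1 := by
      simp only [List.mem_cons, List.mem_nil_iff, or_false] at he
      rcases he with rfl | rfl | rfl | rfl
      · rw [show (⟨p.base, p.dir₁⟩ : Edge r).src = p.src from rfl, sub_self, norm_zero]; exact zero_le_one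
      · rw [src_add_single₈ p.base p.dir₁ p.dir₂ p.dir₁, show (⟨p.base, p.dir₁⟩ : Edge r).src = p.src from rfl,
          add_sub_cancel_left, norm_smul, hu, mul_one, Real.norm_of_nonneg hℓr.le]; exact hℓr1
      · rw [src_add_single₈ p.base p.dir₂ p.dir₁ p.dir₁, show (⟨p.base, p.dir₁⟩ : Edge r).src = p.src from rfl,
          add_sub_cancel_left, norm_smul, hu, mul_one, Real.norm_of_nonneg hℓr.le]; exact hℓr1
      · rw [show (⟨p.base, p.dir₂⟩ : Edge r).src = p.src from rfl, sub_self, norm_zero]; exact zero_le_one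
    have : ‖p.src‖ ≤ ‖e.src‖ + ‖e.src - p.src‖ := by
      calc ‖p.src‖ = ‖e.src - (e.src - p.src)‖ := by congr 1; abel
        _ ≤ ‖e.src‖ + ‖e.src - p.src‖ := norm_sub_le _ _
    linarith
  -- |g_∂p| ≤ 4ψ(p) for the far plaquettes
  have hplaq : ∀ p : Plaq r, c₀ * polyEnvelope K q (‖p.src‖ - 17) ≤ η₀ →
      absG (S.plaqHol (g r) p) ≤ 4 * (c₀ * polyEnvelope K q (‖p.src‖ - 17)) := by
    intro p hcond
    have h := fun e he => hedge' e (‖p.src‖ - 17) (hsrc p e he) hcond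
    have h1 := h ⟨p.base, p.dir₁⟩ (by simp)
    have h2 := h ⟨p.base + Pi.single p.dir₁ 1, p.dir₂⟩ (by simp)
    have h3 := h ⟨p.base + Pi.single p.dir₂ 1, p.dir₁⟩ (by simp)
    have h4 := h ⟨p.base, p.dir₂⟩ (by simp)
    calc absG (S.plaqHol (g r) p) ≤ _ := S.absG_plaqHol_le_sum (g r) p
      _ ≤ _ := by linarith
  -- the far region: ψ ≤ η₀ beyond a radius R₀
  have htend : Tendsto (fun t : ℝ => c₀ * polyEnvelope K q t) atTop (𝓝 0) := by
    have h1 : Tendsto (fun t : ℝ => 1 + max t 0) atTop atTop := by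
      refine tendsto_atTop_add_const_left _ _ (tendsto_atTop_atTop.2 fun b => ⟨b, fun a ha => ha.trans (le_max_left _ _)⟩)
    have h2 := (tendsto_rpow_neg_atTop (by linarith : (0 : ℝ) < q)).comp h1
    have h3 : Tendsto (fun t : ℝ => c₀ * (K * (1 + max t 0) ^ (-q))) atTop (𝓝 (c₀ * (K * 0))) :=
      (h2.const_mul K).const_mul c₀
    rw [mul_zero, mul_zero] at h3
    exact h3
  obtain ⟨R₀, hR₀⟩ : ∃ R₀ : ℝ, ∀ t, R₀ ≤ t → c₀ * polyEnvelope K q t ≤ η₀ := by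
    obtain ⟨R₀, h⟩ := (htend.eventually (eventually_le_nhds hη₀)).exists_forall_of_atTop
    exact ⟨R₀, h⟩
  have hfar : ∀ p : Plaq r, R₀ ≤ ‖p.src‖ - 17 →
      S.plaqActionTermOriented r (g r) p ≤ 16 * (c₀ * polyEnvelope K q (‖p.src‖ - 17)) ^ 2 := by
    intro p hp
    have h := hplaq p (hR₀ _ hp)
    have h0 : 0 ≤ absG (S.plaqHol (g r) p) := absG_nonneg _
    unfold plaqActionTermOriented
    split_ifs
    · nlinarith
    · positivity
  -- the dominating family is summable
  have hdomsum : Summable fun p : Plaq r => 16 * (c₀ * polyEnvelope K q (‖p.src‖ - 17)) ^ 2 := by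
    have hbase : Summable fun b : Fin 4 → ℤ => ∑ μ : Fin 4, ∑ ν : Fin 4,
        16 * (c₀ * polyEnvelope K q (‖(⟨b, μ, ν⟩ : Plaq r).src‖ - 17)) ^ 2 := by
      have hint : Integrable fun x : E4 => (polyEnvelope K q (‖x‖ - 19) + polyEnvelope 0 q (‖x‖ - 19)) ^ 2 :=
        integrable_polyEnvelope_sum_sq hK le_rfl hq (by norm_num) (by norm_num)
      refine LatticeRiemann.summable_of_dominated hℓr _ _ ((hint.const_mul (16 * (16 * c₀ ^ 2)))) fun x => ?_
      have hx : ‖x - cornerPt (latLen r) (floorIdx (latLen r) x)‖ ≤ 2 * latLen r := norm_sub_cornerPt_le hℓr x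
      have hsrc' : ∀ μ ν : Fin 4, (⟨floorIdx (latLen r) x, μ, ν⟩ : Plaq r).src = cornerPt (latLen r) (floorIdx (latLen r) x) :=
        fun μ ν => rfl
      have hmono : polyEnvelope K q (‖cornerPt (latLen r) (floorIdx (latLen r) x)‖ - 17) ≤ polyEnvelope K q (‖x‖ - 19) := by
        refine henv_anti ?_
        have : ‖x‖ ≤ ‖cornerPt (latLen r) (floorIdx (latLen r) x)‖ + ‖x - cornerPt (latLen r) (floorIdx (latLen r) x)‖ := by
          calc ‖x‖ = ‖cornerPt (latLen r) (floorIdx (latLen r) x) + (x - cornerPt (latLen r) (floorIdx (latLen r) x))‖ := by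
                congr 1; abel
            _ ≤ _ := norm_add_le _ _
        linarith
      have h0 : polyEnvelope 0 q (‖x‖ - 19) = 0 := by unfold polyEnvelope; ring
      have hp0 := polyEnvelope_nonneg hK q (‖cornerPt (latLen r) (floorIdx (latLen r) x)‖ - 17)
      have h1 : (c₀ * polyEnvelope K q (‖cornerPt (latLen r) (floorIdx (latLen r) x)‖ - 17)) ^ 2 ≤
          c₀ ^ 2 * polyEnvelope K q (‖x‖ - 19) ^ 2 := by
        rw [mul_pow]; exact mul_le_mul_of_nonneg_left (pow_le_pow_left₀ hp0 hmono 2) (sq_nonneg _)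
      rw [abs_of_nonneg (Finset.sum_nonneg fun μ _ => Finset.sum_nonneg fun ν _ => by positivity)]
      simp only [hsrc', Finset.sum_const, Finset.card_univ, Fintype.card_fin, nsmul_eq_mul, Nat.cast_ofNat, h0,
        add_zero]
      nlinarith [h1, sq_nonneg c₀]
    exact (tsum_plaq_eq_tsum_base (fun p : Plaq r => 16 * (c₀ * polyEnvelope K q (‖p.src‖ - 17)) ^ 2)
      (fun p => by positivity) hbase).1
  -- finitely many exceptions
  refine Summable.of_norm_bounded_eventually hdomsum ?_
  rw [Filter.eventually_cofinite]
  refine (finite_plaq_norm_src_lt r (R₀ + 17)).subset fun p hp => ?_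
  simp only [Set.mem_setOf_eq, not_le] at hp ⊢
  by_contra hlt
  rw [not_lt] at hlt
  have h := hfar p (by linarith)
  have h0 : 0 ≤ S.plaqActionTermOriented r (g r) p := S.plaqActionTermOriented_nonneg r (g r) p
  rw [Real.norm_of_nonneg h0] at hp
  linarith

end BlockSpinSystem

end

end Literature.MathematicalPhysics.QuantumFieldTheory.Federbush1986
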